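import Mathlib
import HarnessLib
import Literature.MathematicalPhysics.StatisticalMechanics.StrongNormExpLipschitz

/-!
# Products of two exponential atoms on one block in the strong norm ([ABKM19] Lemma 9.3, `D²E`):
# `|(e^{H₁(B)} − 1)(e^{H₂(B)} − 1)|_{T_φ} ≤ 256 e^{1/4} ‖H₁‖_{k,0}‖H₂‖_{k,0} W(φ)` for `‖Hᵢ‖_{k,0} ≤ 1/16`

The second derivative `D²E(H)(Ḣ₁,Ḣ₂) = e^{H}Ḣ₁Ḣ₂` of [ABKM19] Lemma 9.3 is a product of two
block functionals on the SAME block; in the strong norm such a product cannot be bounded by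
submultiplicativity of the weights (`(W_k^B)² ≰ W_k^B`), but it is bounded directly at the level of the
`ℓ²` domination: `|Hᵢ(B)|_{T_φ} ≤ 2(1+N²)‖Hᵢ‖`, `(1+N²)² ≤ 64e^{N²/4}`, `e^{t₁+t₂} ≤ e^{1/4}e^{N²/4}`.
This is the atom used for the Lipschitz bound of the fluctuation defect and of `e^{−u} − 1 − u`.

* **`tayNormLE_cexp_eval_sub_one_mul`** — abstract `ℓ²`-dominating weight;
* **`tayNormLE_cexp_neg_eval_sub_one_mul`** — Boltzmann factors `(e^{−H₁(B)} − 1)(e^{−H₂(B)} − 1)`;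
* **`tayNormLE_expNegH_sub_one_mul_strong_abkm`** — the torus tower's strong weight.

Everything is proved; no named fact.

## References
* S. Adams, S. Buchholz, R. Kotecký, S. Müller, arXiv:1910.13564, Lemma 9.3 ((9.13)–(9.16))
  [AdamsBuchholzKoteckyMuller2019].
-/

noncomputable section

namespace Literature.MathematicalPhysics.StatisticalMechanics.GradientRG

open scoped BigOperators
open Finset
open Literature.MathematicalPhysics.QuantumFieldTheory
open Literature.MathematicalPhysics.StatisticalMechanics.TorusPolymer (blockOf)

variable {d M : ℕ} [NeZero M]

/-- `(1 + N²)² ≤ 64 e^{N²/4}`. [folklore] -/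
private theorem one_add_sq_sq_le' (N : ℝ) : (1 + N ^ 2) ^ 2 ≤ 64 * Real.exp (N ^ 2 / 4) := by
  have h1 : 1 + N ^ 2 ≤ 8 * Real.exp (N ^ 2 / 8) := by
    have := Real.add_one_le_exp (N ^ 2 / 8)
    nlinarith [sq_nonneg N]
  have h0 : 0 ≤ 1 + N ^ 2 := by positivity
  have hsq : Real.exp (N ^ 2 / 8) * Real.exp (N ^ 2 / 8) = Real.exp (N ^ 2 / 4) := by
    rw [← Real.exp_add]; ring_nf
  calc (1 + N ^ 2) ^ 2 ≤ (8 * Real.exp (N ^ 2 / 8)) ^ 2 := pow_le_pow_left₀ h0 h1 2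
    _ = 64 * Real.exp (N ^ 2 / 4) := by rw [mul_pow, ← hsq]; ring

/-- **Product of two exponential atoms on one block**: for an `ℓ²`-dominating weight `W` and
`‖H₁‖_{k,0}, ‖H₂‖_{k,0} ≤ 1/16`,
`‖(e^{H₁(B)} − 1)(e^{H₂(B)} − 1)‖_{T, W} ≤ 256 e^{1/4} ‖H₁‖_{k,0} ‖H₂‖_{k,0}`.
[cite: AdamsBuchholzKoteckyMuller2019, Lemma 9.3 (9.13)] -/
theorem tayNormLE_cexp_eval_sub_one_mul {𝔥 R : ℝ} (h𝔥 : 0 < 𝔥) (hR : 0 < R) {p : ℕ}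
    (hp : d / 2 + 1 ≤ p) {S B : Finset (Fin d → ZMod M)} (hBS : B ⊆ S)
    {W : ((Fin d → ZMod M) → ℝ) → ℝ} (hW : Ell2Dominates B 𝔥 R W) {H₁ H₂ : RelevantHamiltonian ℂ d}
    (r₀ : ℕ) (hH₁ : hamNorm 𝔥 R B.card H₁ ≤ 1 / 16) (hH₂ : hamNorm 𝔥 R B.card H₂ ≤ 1 / 16) :
    TayNormLE (fieldGauge 𝔥 R p S) r₀ W
      (fun ψ : (Fin d → ZMod M) → ℝ => (Complex.exp (eval H₁ B ψ) - 1) * (Complex.exp (eval H₂ B ψ) - 1))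
      (256 * Real.exp (1 / 4) * hamNorm 𝔥 R B.card H₁ * hamNorm 𝔥 R B.card H₂) := by
  intro φ
  obtain ⟨N, hN0, hNlin, hNgrad, hNW⟩ := hW φ
  set T := fieldGauge 𝔥 R p S with hT
  set n₁ := hamNorm 𝔥 R B.card H₁ with hn₁
  set n₂ := hamNorm 𝔥 R B.card H₂ with hn₂
  have hn₁0 : 0 ≤ n₁ := hamNorm_nonneg h𝔥.le hR.le _ _
  have hn₂0 : 0 ≤ n₂ := hamNorm_nonneg h𝔥.le hR.le _ _
  have hd₁ : ContDiff ℝ r₀ (fun ψ : (Fin d → ZMod M) → ℝ => Complex.exp (eval H₁ B ψ) - 1) :=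
    (contDiff_eval H₁ B).cexp.sub contDiff_const
  have hd₂ : ContDiff ℝ r₀ (fun ψ : (Fin d → ZMod M) → ℝ => Complex.exp (eval H₂ B ψ) - 1) :=
    (contDiff_eval H₂ B).cexp.sub contDiff_const
  have hmul := tayNorm_mul_le T hd₁ hd₂ φ
  refine hmul.trans ?_
  set t₁ := tayNorm T r₀ (fun ψ : (Fin d → ZMod M) → ℝ => eval H₁ B ψ) φ with ht₁
  set t₂ := tayNorm T r₀ (fun ψ : (Fin d → ZMod M) → ℝ => eval H₂ B ψ) φ with ht₂
  have ht₁0 : 0 ≤ t₁ := tayNorm_nonneg _ _ _ _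
  have ht₂0 : 0 ≤ t₂ := tayNorm_nonneg _ _ _ _
  have h1 : tayNorm T r₀ (fun ψ : (Fin d → ZMod M) → ℝ => Complex.exp (eval H₁ B ψ) - 1) φ ≤
      t₁ * Real.exp t₁ := tayNorm_cexp_sub_one_le T (contDiff_eval H₁ B (n := r₀)) φ
  have h2 : tayNorm T r₀ (fun ψ : (Fin d → ZMod M) → ℝ => Complex.exp (eval H₂ B ψ) - 1) φ ≤
      t₂ * Real.exp t₂ := tayNorm_cexp_sub_one_le T (contDiff_eval H₂ B (n := r₀)) φ
  have hb₁ : t₁ ≤ (1 + N ^ 2) * (2 * n₁) :=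
    tayNorm_eval_le_quarter (𝕜 := ℂ) h𝔥 hR hp hBS (H := H₁) (r₀ := r₀) hN0 hNlin hNgrad
  have hb₂ : t₂ ≤ (1 + N ^ 2) * (2 * n₂) :=
    tayNorm_eval_le_quarter (𝕜 := ℂ) h𝔥 hR hp hBS (H := H₂) (r₀ := r₀) hN0 hNlin hNgrad
  have hN2 : 0 ≤ 1 + N ^ 2 := by positivity
  have ht₁q : t₁ ≤ (1 + N ^ 2) / 8 := by
    have := mul_le_mul_of_nonneg_left (show 2 * n₁ ≤ 2 * (1 / 16) by linarith) hN2; linarith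
  have ht₂q : t₂ ≤ (1 + N ^ 2) / 8 := by
    have := mul_le_mul_of_nonneg_left (show 2 * n₂ ≤ 2 * (1 / 16) by linarith) hN2; linarith
  have hexp : Real.exp t₁ * Real.exp t₂ ≤ Real.exp (1 / 4) * Real.exp (N ^ 2 / 4) := by
    rw [← Real.exp_add, ← Real.exp_add]; exact Real.exp_le_exp.2 (by linarith)
  have hq := one_add_sq_sq_le' N
  have hsq : Real.exp (N ^ 2 / 4) * Real.exp (N ^ 2 / 4) = Real.exp (N ^ 2 / 2) := by
    rw [← Real.exp_add]; ring_nf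
  have htt : t₁ * t₂ ≤ (1 + N ^ 2) ^ 2 * (4 * (n₁ * n₂)) := by
    calc t₁ * t₂ ≤ ((1 + N ^ 2) * (2 * n₁)) * ((1 + N ^ 2) * (2 * n₂)) :=
          mul_le_mul hb₁ hb₂ ht₂0 (mul_nonneg hN2 (by linarith))
      _ = (1 + N ^ 2) ^ 2 * (4 * (n₁ * n₂)) := by ring
  refine (mul_le_mul h1 h2 (tayNorm_nonneg _ _ _ _) (mul_nonneg ht₁0 (Real.exp_pos _).le)).trans ?_
  calc t₁ * Real.exp t₁ * (t₂ * Real.exp t₂) = (t₁ * t₂) * (Real.exp t₁ * Real.exp t₂) := by ring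
    _ ≤ ((1 + N ^ 2) ^ 2 * (4 * (n₁ * n₂))) * (Real.exp (1 / 4) * Real.exp (N ^ 2 / 4)) :=
        mul_le_mul htt hexp (by positivity) (by positivity)
    _ ≤ (64 * Real.exp (N ^ 2 / 4) * (4 * (n₁ * n₂))) * (Real.exp (1 / 4) * Real.exp (N ^ 2 / 4)) := by
        gcongr
    _ = 256 * Real.exp (1 / 4) * n₁ * n₂ * (Real.exp (N ^ 2 / 4) * Real.exp (N ^ 2 / 4)) := by ring
    _ = 256 * Real.exp (1 / 4) * n₁ * n₂ * Real.exp (N ^ 2 / 2) := by rw [hsq]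
    _ ≤ 256 * Real.exp (1 / 4) * n₁ * n₂ * W φ := mul_le_mul_of_nonneg_left hNW (by positivity)

/-- **Product of two Boltzmann atoms**: `‖(e^{−H₁(B)} − 1)(e^{−H₂(B)} − 1)‖_{T,W} ≤ 256e^{1/4}‖H₁‖‖H₂‖`
for `‖Hᵢ‖_{k,0} ≤ 1/16`. [cite: AdamsBuchholzKoteckyMuller2019, Lemma 9.3 (9.13)] -/
theorem tayNormLE_cexp_neg_eval_sub_one_mul {𝔥 R : ℝ} (h𝔥 : 0 < 𝔥) (hR : 0 < R) {p : ℕ}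
    (hp : d / 2 + 1 ≤ p) {S B : Finset (Fin d → ZMod M)} (hBS : B ⊆ S)
    {W : ((Fin d → ZMod M) → ℝ) → ℝ} (hW : Ell2Dominates B 𝔥 R W) {H₁ H₂ : RelevantHamiltonian ℂ d}
    (r₀ : ℕ) (hH₁ : hamNorm 𝔥 R B.card H₁ ≤ 1 / 16) (hH₂ : hamNorm 𝔥 R B.card H₂ ≤ 1 / 16) :
    TayNormLE (fieldGauge 𝔥 R p S) r₀ W
      (fun ψ : (Fin d → ZMod M) → ℝ =>
        (Complex.exp (-(eval H₁ B ψ)) - 1) * (Complex.exp (-(eval H₂ B ψ)) - 1))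
      (256 * Real.exp (1 / 4) * hamNorm 𝔥 R B.card H₁ * hamNorm 𝔥 R B.card H₂) := by
  have hfun : (fun ψ : (Fin d → ZMod M) → ℝ =>
      (Complex.exp (-(eval H₁ B ψ)) - 1) * (Complex.exp (-(eval H₂ B ψ)) - 1)) =
      fun ψ => (Complex.exp (eval (-H₁) B ψ) - 1) * (Complex.exp (eval (-H₂) B ψ) - 1) := by
    funext ψ; rw [eval_neg, eval_neg]
  rw [hfun, ← hamNorm_neg 𝔥 R B.card H₁, ← hamNorm_neg 𝔥 R B.card H₂]
  exact tayNormLE_cexp_eval_sub_one_mul h𝔥 hR hp hBS hW r₀ (by rwa [hamNorm_neg]) (by rwa [hamNorm_neg])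

/-- **Product of two Boltzmann atoms for the torus tower**: on `B = B_x` at scale `k ≤ N` with the
strong weight `W_k^B` and `‖Hᵢ‖_{k,0} ≤ 1/16`:
`‖(e^{−H₁(B)} − 1)(e^{−H₂(B)} − 1)‖_{T, W_k^B} ≤ 256e^{1/4}‖H₁‖_{k,0}‖H₂‖_{k,0}`.
[cite: AdamsBuchholzKoteckyMuller2019, Lemma 9.3 (9.13)] -/
theorem tayNormLE_expNegH_sub_one_mul_strong_abkm {L N Mord R k p : ℕ} {h : ℝ} (hd : 2 ≤ d)
    (hLodd : Odd L) (hM : M = L ^ N) (hk : k ≤ N) (hh : 0 < h) (hMord : d / 2 + 1 ≤ Mord)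
    (hp : d / 2 + 1 ≤ p) {x : Fin d → ZMod M} {S : Finset (Fin d → ZMod M)}
    (hBS : blockOf (L ^ k) x ⊆ S) {H₁ H₂ : RelevantHamiltonian ℂ d} (r₀ : ℕ)
    (hH₁ : hamNorm (fieldWt h (L : ℝ) d k) ((L : ℝ) ^ k) (blockOf (L ^ k) x).card H₁ ≤ 1 / 16)
    (hH₂ : hamNorm (fieldWt h (L : ℝ) d k) ((L : ℝ) ^ k) (blockOf (L ^ k) x).card H₂ ≤ 1 / 16) :
    TayNormLE (fieldGauge (fieldWt h (L : ℝ) d k) ((L : ℝ) ^ k) p S) r₀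
      (expWeight (strongCoef h N k • derivForm (L : ℝ) k (diffIndex d Mord)
        (boxDensity (boxRad R L k) (boxWt (L : ℝ) d k) (blockOf (L ^ k) x))))
      (fun ψ : (Fin d → ZMod M) → ℝ =>
        (expNegH H₁ (blockOf (L ^ k) x) ψ - 1) * (expNegH H₂ (blockOf (L ^ k) x) ψ - 1))
      (256 * Real.exp (1 / 4) * hamNorm (fieldWt h (L : ℝ) d k) ((L : ℝ) ^ k) (blockOf (L ^ k) x).card H₁ *
        hamNorm (fieldWt h (L : ℝ) d k) ((L : ℝ) ^ k) (blockOf (L ^ k) x).card H₂) := by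
  have hL0 : (0 : ℝ) < L := by exact_mod_cast hLodd.pos
  exact tayNormLE_cexp_neg_eval_sub_one_mul (fieldWt_pos hh hL0 d k) (by positivity) hp hBS
    (ell2Dominates_strongWeight_abkm (R := R) hd hLodd hM hk hh hMord x) r₀ hH₁ hH₂

end Literature.MathematicalPhysics.StatisticalMechanics.GradientRG

end
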